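import Summits.QuantumFields.YangMills.Theorems.DiagonalMirrorRPRWilsonDiagonalModelOddTorusChain
import Summits.QuantumFields.YangMills.Theorems.DiagonalMirrorRPRDiagonalSliceModelDefs
import Summits.QuantumFields.YangMills.Theorems.PencilRigidityDiagonalMirrorRPRStubRpClosureSupport

/-!
# Crux `WeakCouplingHypercubicLimitRP` (stmt-QuantumFields-27398) / aside `DiagonalMirrorRPR` (stmt-QuantumFields-10604), door B,
# construction F1_diag — PAIRING LAYER, step P1: SLAB SUPPORT of the family observable in the symmetric chart of the own odd torus

Helper file (`--supports stmt-QuantumFields-27398 --as helper`) of the hand `hand-10604-wilsonDiagModel-2` (docket director-ym g23, O4 WORD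
18 (3)(iii) / 20 (1): continue π1′ from hand-10604-wilsonDiagModel-1's helpers towards `def wilsonDiagonalModel : DiagonalSliceModel r sch`;
step P1 of that hand's ROADMAP-F1diag v4 §1⅞) for the registered stub D1 `stub_diagRPOfPlaneLimits` of
`Cruxes/WeakCouplingHypercubicLimitRP/Lines/Sketch.lean` (sha16 `7bf38c709623ad77`); it closes nothing by itself.

WHAT.  In the symmetric light-cone chart `(v, u) = (x₀ − x₁, x₀ + x₁)` of the scheme's own ODD torus (`lcSite`, `layerReadU`,
`layerAssembleU` of `…WilsonDiagonalModelOddTorus`, hand-1 p825676) a torus configuration is a string of layers `Z_v`, `v ∈ ℤ/Sℤ`; the edge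
`(x, i)` lies in layer `v(x) + [i = 0]`.
* §1 `lcEdge_fst_proj` (the layer of the torus edge below `(y, i) ∈ ℤ⁴ × 4` is `y₀ − y₁ + [i = 0] mod S`), `apply_eq_layerReadU` (a configuration
  is read off its layers), and the CYLINDER LEMMA `smearedLatticeField_torusLift_congr`: if every lattice point `x ∈ Λ` charged by the test
  function has slab index `x₀ − x₁` with `lo + 2ϱ ≤ x₀ − x₁` and `x₀ − x₁ + 2ϱ + 1 ≤ hi` (`ϱ` a radius of the observable's edge support,
  `exists_radius`), then the smeared field at the periodic lift depends only on the layers `t ∈ [lo, hi]` (cast to `ℤ/Sℤ`); the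
  `layerAssembleU` form `smearedLatticeField_torusLift_layerAssembleU_congr` is the one the cyclic-chain formula `latticeSchwinger_eq_diagCyclicU`
  (hand-1 p825750) consumes.
* §2 the geometry of a reflected family's supports: `exists_slab_margins` — compact supports in the open half-space `{x₁ < x₀}` have
  `0 < δ ≤ x₀ − x₁ ≤ R` uniformly; hence the charged lattice points at spacing `a` have integer slab index in `[δ/a, R/a]`.
* §3 **`exists_famDepth`** (P1): for every reflected family `F` there is a depth sequence `d : ℕ → ℕ` with (i) `a_k · d_k ≤ R'` eventually (the
  interface field `depth_le`), (ii) `2 d_k < side_k` eventually (the first conjunct of `pairing_eq`), (iii) eventually in `k`, the family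
  observable `famObs r sch F k` at the periodic lift of a torus configuration depends only on the layers `1, …, d_k` (both the `layerReadU` and
  the `layerAssembleU` forms).  This is the support bookkeeping the insertion form (P2), the sandwich identity (P3) and weight domination (P4)
  of the pairing layer start from; the mirrored family lives in layers `−d_k, …, −1` by the fibrewise swap (`lcSite_sitePerm_swap`, P1′, not here).

HONEST FRAMING: construction bookkeeping only; `wilsonDiagonalModel` is NOT landed (P2–P4 + assembly remain, sized in hand-1's ROADMAP-F1diag v4
§1⅞); no letter is proved; D1, ⟨27398⟩, S6i and the aside ⟨10604⟩ are OPEN; nothing here bears on the summit; the Yang–Mills mass gap is NOT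
proved here or anywhere in the tree.  No definition, no instance, no notation, `autoImplicit false`.

References: K. Osterwalder, E. Seiler, Ann. Phys. 110 (1978) §2–3 (transfer matrix, time-slab localisation of observables); E. Seiler, LNP
159 (1982) Ch. 2.
-/

set_option autoImplicit false

noncomputable section

open scoped SchwartzMap
open MeasureTheory Filter Topology
open Literature.MathematicalPhysics.QuantumLattice Literature.MathematicalPhysics.QuantumFieldTheory
open Literature.Probability.LatticeModels (box Site mem_box)
open Summit.QuantumFields.YangMills.Cruxes.DiagonalMirrorRPR.ParityBridgeColdTraces

namespace Summit.QuantumFields.YangMills.Cruxes.DiagonalMirrorRPR.SignTwistedDiagonalTrace.WilsonDiagonal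

/-! ## §1 The layer of a lifted edge; the cylinder lemma on the own odd torus -/

section Cylinder

variable {S : ℕ}

/-- The layer index of the torus edge below `(y, i) ∈ ℤ⁴ × 4`: `y₀ − y₁ + [i = 0]` reduced mod `S`. -/
theorem lcEdge_fst_proj (y : Site 4) (i : Fin 4) :
    (lcEdge ((Literature.Probability.LatticeModels.Torus.proj S y, i) :
        Literature.MathematicalPhysics.QuantumFieldTheory.Edge 4 S)).1 =
      (((y 0 - y 1 + if i = 0 then 1 else 0 : ℤ)) : ZMod S) := by
  by_cases h : i = 0
  · simp [lcEdge, lcSite, Literature.Probability.LatticeModels.Torus.proj, h]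
  · simp [lcEdge, lcSite, Literature.Probability.LatticeModels.Torus.proj, h]

/-- A torus configuration is read off its symmetric-chart layers (odd `S`): `U e = Z_{layer e} (label e)`. -/
theorem apply_eq_layerReadU {G : Type*} (hS : Odd S) (U : GaugeConfig 4 S G)
    (e : Literature.MathematicalPhysics.QuantumFieldTheory.Edge 4 S) :
    U e = layerReadU U (lcEdge e).1 (lcEdge e).2 := by
  conv_lhs => rw [← layerAssembleU_layerReadU hS U]
  rfl

variable {G : Type} [Group G] [MeasurableSpace G]

/-- **Cylinder lemma on the own odd torus (symmetric chart).**  Let `ϱ` be a radius of the edge support of the observable `O`.  If every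
lattice point `x ∈ Λ` charged by the test function `h` at spacing `a` has slab index `x₀ − x₁` with `lo + 2ϱ ≤ x₀ − x₁` and
`x₀ − x₁ + 2ϱ + 1 ≤ hi`, then the smeared field of `O` at the periodic lift of a torus configuration depends only on the layers `t ∈ [lo, hi]`
(cast into `ℤ/Sℤ`). -/
theorem smearedLatticeField_torusLift_congr (hS : Odd S) (O : YMSpecies G) {ϱ : ℕ} (hϱ : ∀ e ∈ O.supp, ∀ i, |e.1 i| ≤ (ϱ : ℤ))
    (Λ : Finset (Site 4)) (a cc m : ℝ) (h : 𝓢(E4, ℝ)) {lo hi : ℤ}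
    (hsupp : ∀ x ∈ Λ, h (a • siteToE x) ≠ 0 → lo + 2 * ϱ ≤ x 0 - x 1 ∧ x 0 - x 1 + 2 * ϱ + 1 ≤ hi)
    {U U' : GaugeConfig 4 S G} (hUU' : ∀ t : ℤ, lo ≤ t → t ≤ hi → layerReadU U (t : ZMod S) = layerReadU U' (t : ZMod S)) :
    smearedLatticeField O.F Λ a cc m h (torusLift S U) = smearedLatticeField O.F Λ a cc m h (torusLift S U') := by
  unfold smearedLatticeField
  congr 1
  refine Finset.sum_congr rfl fun x hx => ?_
  by_cases h0 : h (a • siteToE x) = 0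
  · rw [h0, zero_mul, zero_mul]
  congr 2
  refine O.isCylinder fun e he => ?_
  obtain ⟨hlo, hhi⟩ := hsupp x hx h0
  have he0 := hϱ e (Finset.mem_coe.1 he) 0
  have he1 := hϱ e (Finset.mem_coe.1 he) 1
  rw [abs_le] at he0 he1
  simp only [configShift_apply]
  change U (Literature.Probability.LatticeModels.Torus.proj S (e.1 - -x), e.2) =
    U' (Literature.Probability.LatticeModels.Torus.proj S (e.1 - -x), e.2)
  rw [apply_eq_layerReadU hS U, apply_eq_layerReadU hS U', lcEdge_fst_proj]
  set t : ℤ := (e.1 - -x) 0 - (e.1 - -x) 1 + (if e.2 = 0 then 1 else 0) with ht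
  have h01 : (e.1 - -x) 0 - (e.1 - -x) 1 = (x 0 - x 1) + (e.1 0 - e.1 1) := by
    simp only [Pi.sub_apply, Pi.neg_apply]; ring
  have hind : (0 : ℤ) ≤ (if e.2 = 0 then 1 else 0 : ℤ) ∧ (if e.2 = 0 then 1 else 0 : ℤ) ≤ 1 := by
    split_ifs <;> simp
  have htlo : lo ≤ t := by rw [ht, h01]; omega
  have hthi : t ≤ hi := by rw [ht, h01]; omega
  rw [hUU' t htlo hthi]

/-- The same in the `layerAssembleU` form consumed by the cyclic-chain formula `latticeSchwinger_eq_diagCyclicU`: the smeared field at the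
periodic lift of the configuration assembled from layers `Z` depends only on `Z t`, `t ∈ [lo, hi]`. -/
theorem smearedLatticeField_torusLift_layerAssembleU_congr (hS : Odd S) (O : YMSpecies G) {ϱ : ℕ}
    (hϱ : ∀ e ∈ O.supp, ∀ i, |e.1 i| ≤ (ϱ : ℤ)) (Λ : Finset (Site 4)) (a cc m : ℝ) (h : 𝓢(E4, ℝ)) {lo hi : ℤ}
    (hsupp : ∀ x ∈ Λ, h (a • siteToE x) ≠ 0 → lo + 2 * ϱ ≤ x 0 - x 1 ∧ x 0 - x 1 + 2 * ϱ + 1 ≤ hi)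
    {Z Z' : ZMod S → LayerCfg S S G} (hZZ' : ∀ t : ℤ, lo ≤ t → t ≤ hi → Z (t : ZMod S) = Z' (t : ZMod S)) :
    smearedLatticeField O.F Λ a cc m h (torusLift S (layerAssembleU Z)) =
      smearedLatticeField O.F Λ a cc m h (torusLift S (layerAssembleU Z')) := by
  refine smearedLatticeField_torusLift_congr hS O hϱ Λ a cc m h hsupp fun t htlo hthi => ?_
  rw [layerReadU_layerAssembleU hS, layerReadU_layerAssembleU hS]
  exact hZZ' t htlo hthi

end Cylinder

/-! ## §2 Geometry of a reflected family's supports: uniform slab margins -/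

section Margins

/-- **Slab margins of a reflected family.**  The compact supports of the test functions of a reflected family lie in the open half-space
`{x₁ < x₀}`, hence in a closed slab `{δ ≤ x₀ − x₁ ≤ R}` with `0 < δ` (minimum and maximum of the continuous `x ↦ x₀ − x₁` on the compact
union of the supports). -/
theorem exists_slab_margins (F : ReflectedFamily) :
    ∃ δ R : ℝ, 0 < δ ∧ ∀ i j (x : E4), x ∈ tsupport (F.f i j : E4 → ℝ) → δ ≤ x 0 - x 1 ∧ x 0 - x 1 ≤ R := by
  -- the union of the supports is compact and lies in the open half-space
  set K : Set E4 := ⋃ i, ⋃ j, tsupport (F.f i j : E4 → ℝ) with hK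
  have hKc : IsCompact K := isCompact_iUnion fun i => isCompact_iUnion fun j => (F.compact i j).isCompact
  have hKsub : K ⊆ {x : E4 | x 1 < x 0} := Set.iUnion_subset fun i => Set.iUnion_subset fun j => F.half i j
  have hg : Continuous fun x : E4 => x 0 - x 1 := by fun_prop
  by_cases hne : K.Nonempty
  · obtain ⟨xm, hxm, hmin⟩ := hKc.exists_isMinOn hne hg.continuousOn
    obtain ⟨xM, hxM, hmax⟩ := hKc.exists_isMaxOn hne hg.continuousOn
    refine ⟨xm 0 - xm 1, xM 0 - xM 1, sub_pos.2 (hKsub hxm), fun i j x hx => ?_⟩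
    have hxK : x ∈ K := Set.mem_iUnion.2 ⟨i, Set.mem_iUnion.2 ⟨j, hx⟩⟩
    exact ⟨hmin hxK, hmax hxK⟩
  · refine ⟨1, 1, one_pos, fun i j x hx => ?_⟩
    exact absurd ⟨x, Set.mem_iUnion.2 ⟨i, Set.mem_iUnion.2 ⟨j, hx⟩⟩⟩ hne

/-- At spacing `a > 0`, a lattice point charged by a test function supported in the slab `{δ ≤ x₀ − x₁ ≤ R}` has slab index in
`[δ/a, R/a]`. -/
theorem slabIndex_bounds_of_charged {f : 𝓢(E4, ℝ)} {δ R a : ℝ} (ha : 0 < a)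
    (hf : ∀ x : E4, x ∈ tsupport (f : E4 → ℝ) → δ ≤ x 0 - x 1 ∧ x 0 - x 1 ≤ R) (x : Site 4)
    (hx : f (a • siteToE x) ≠ 0) : δ / a ≤ ((x 0 - x 1 : ℤ) : ℝ) ∧ ((x 0 - x 1 : ℤ) : ℝ) ≤ R / a := by
  have hmem : a • siteToE x ∈ tsupport (f : E4 → ℝ) := subset_tsupport _ (Function.mem_support.2 hx)
  obtain ⟨h1, h2⟩ := hf _ hmem
  have hcoord : (a • siteToE x) 0 - (a • siteToE x) 1 = a * ((x 0 - x 1 : ℤ) : ℝ) := by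
    simp only [PiLp.smul_apply, siteToE_apply, smul_eq_mul]; push_cast; ring
  rw [hcoord] at h1 h2
  exact ⟨(div_le_iff₀ ha).2 (by linarith), (le_div_iff₀ ha).2 (by linarith)⟩

end Margins

/-! ## §3 P1: the depth of a reflected family and the slab support of its observable -/

section Depth

variable {G : Type} [Group G] [TopologicalSpace G] [IsTopologicalGroup G] [CompactSpace G]
  [MeasurableSpace G] [BorelSpace G] (r : LatticeRep G) (sch : SpeciesScheme (YMSpecies G))

/-- **P1 — slab support of the family observable (depth).**  For every reflected family `F` there is a depth sequence `d : ℕ → ℕ` such that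
(i) `a_k · d_k` is eventually bounded (the interface field `depth_le`), (ii) `2 d_k < side_k` eventually (the supports fit in the positive
half of the own torus), and (iii) eventually in `k`, for any two configurations of the scheme's own torus whose symmetric-chart layers
`1, …, d_k` agree, the family observable `Y_k(F)` takes the same value at their periodic lifts.  (`d_k = ⌈R/a_k⌉ + 2ϱ + 1` with `R` the upper
slab margin of the supports and `ϱ` a radius of the curvature's edge support; the lower margin `δ > 0` keeps the charged points at slab index
`≥ δ/a_k ≥ 2ϱ + 1` for large `k`.) -/
theorem exists_famDepth (F : ReflectedFamily) :
    ∃ d : ℕ → ℕ, (∃ R' : ℝ, ∀ᶠ k in atTop, sch.a k * d k ≤ R') ∧ (∀ᶠ k in atTop, 2 * d k < sch.side k) ∧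
      ∀ᶠ k in atTop, ∀ U U' : GaugeConfig 4 (sch.side k) G,
        (∀ t : ℤ, 1 ≤ t → t ≤ d k → layerReadU U (t : ZMod (sch.side k)) = layerReadU U' (t : ZMod (sch.side k))) →
        famObs r sch F k (torusLift (sch.side k) U) = famObs r sch F k (torusLift (sch.side k) U') := by
  obtain ⟨ϱ, hϱ⟩ := RpClosure.exists_radius r.curvature.supp
  obtain ⟨δ, R, hδ, hslab⟩ := exists_slab_margins F
  set Rp : ℝ := max R 0 with hRp
  have hRp0 : 0 ≤ Rp := le_max_right _ _
  have hRRp : R ≤ Rp := le_max_left _ _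
  refine ⟨fun k => ⌈Rp / sch.a k⌉₊ + (2 * ϱ + 1), ?_, ?_, ?_⟩
  · -- (i) `a_k d_k ≤ Rp + 2ϱ + 2` once `a_k ≤ 1`
    refine ⟨Rp + (2 * ϱ + 2), ?_⟩
    have ha1 : ∀ᶠ k in atTop, sch.a k ≤ 1 :=
      ((tendsto_order.1 sch.tendsto_a).2 1 one_pos).mono fun k hk => hk.le
    filter_upwards [ha1] with k hk1
    have ha := sch.a_pos k
    have hceil : (⌈Rp / sch.a k⌉₊ : ℝ) < Rp / sch.a k + 1 := Nat.ceil_lt_add_one (div_nonneg hRp0 ha.le)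
    have h1 : sch.a k * (⌈Rp / sch.a k⌉₊ : ℝ) ≤ Rp + sch.a k := by
      have := mul_le_mul_of_nonneg_left hceil.le ha.le
      rwa [mul_add, mul_one, mul_div_cancel₀ _ ha.ne'] at this
    push_cast
    nlinarith
  · -- (ii) `2 d_k < side_k` eventually: `a_k · 2 d_k` is bounded while `a_k side_k → ∞`
    have ha1 : ∀ᶠ k in atTop, sch.a k ≤ 1 :=
      ((tendsto_order.1 sch.tendsto_a).2 1 one_pos).mono fun k hk => hk.le
    have hx : Tendsto (fun k => sch.a k * (sch.side k : ℝ)) atTop atTop := by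
      refine tendsto_atTop_mono (fun k => ?_) sch.tendsto_L
      have : (sch.L k : ℝ) ≤ (sch.side k : ℝ) := by
        simp only [SpeciesScheme.side]; push_cast; linarith
      exact mul_le_mul_of_nonneg_left this (sch.a_pos k).le
    filter_upwards [ha1, hx.eventually_gt_atTop (2 * (Rp + (2 * ϱ + 2)))] with k hk1 hbig
    have ha := sch.a_pos k
    have hceil : (⌈Rp / sch.a k⌉₊ : ℝ) < Rp / sch.a k + 1 := Nat.ceil_lt_add_one (div_nonneg hRp0 ha.le)
    have h1 : sch.a k * (⌈Rp / sch.a k⌉₊ : ℝ) ≤ Rp + sch.a k := by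
      have := mul_le_mul_of_nonneg_left hceil.le ha.le
      rwa [mul_add, mul_one, mul_div_cancel₀ _ ha.ne'] at this
    have h2 : sch.a k * ((2 * (⌈Rp / sch.a k⌉₊ + (2 * ϱ + 1)) : ℕ) : ℝ) ≤ 2 * (Rp + (2 * ϱ + 2)) := by
      push_cast
      nlinarith
    have h3 : sch.a k * ((2 * (⌈Rp / sch.a k⌉₊ + (2 * ϱ + 1)) : ℕ) : ℝ) < sch.a k * (sch.side k : ℝ) := lt_of_le_of_lt h2 hbig
    exact_mod_cast lt_of_mul_lt_mul_left h3 ha.le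
  · -- (iii) slab support: once `a_k (2ϱ + 1) ≤ δ`, every charged point has slab index in `[2ϱ + 1, ⌈Rp/a_k⌉]`
    have hsmall : ∀ᶠ k in atTop, sch.a k * (2 * ϱ + 1) ≤ δ := by
      have h0 : Tendsto (fun k => sch.a k * (2 * ϱ + 1 : ℝ)) atTop (𝓝 (0 * (2 * ϱ + 1 : ℝ))) :=
        sch.tendsto_a.mul_const _
      rw [zero_mul] at h0
      exact ((tendsto_order.1 h0).2 δ hδ).mono fun k hk => hk.le
    filter_upwards [hsmall] with k hk U U' hUU'
    have ha := sch.a_pos k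
    have hS : Odd (sch.side k) := ⟨sch.L k, rfl⟩
    -- each smeared factor only charges points of slab index in the window
    have hwin : ∀ i j, ∀ x ∈ box 4 (sch.L k), F.f i j (sch.a k • siteToE x) ≠ 0 →
        (1 : ℤ) + 2 * ϱ ≤ x 0 - x 1 ∧ x 0 - x 1 + 2 * ϱ + 1 ≤ ((⌈Rp / sch.a k⌉₊ + (2 * ϱ + 1) : ℕ) : ℤ) := by
      intro i j x _ hx
      obtain ⟨hlo, hhi⟩ := slabIndex_bounds_of_charged ha (hslab i j) x hx
      have hlo' : ((2 * ϱ + 1 : ℕ) : ℝ) ≤ ((x 0 - x 1 : ℤ) : ℝ) := by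
        refine le_trans ?_ hlo
        rw [le_div_iff₀ ha]
        push_cast
        linarith
      have hhi' : ((x 0 - x 1 : ℤ) : ℝ) ≤ (⌈Rp / sch.a k⌉₊ : ℝ) :=
        (hhi.trans (div_le_div_of_nonneg_right hRRp ha.le)).trans (Nat.le_ceil _)
      have hlo'' : ((2 * ϱ + 1 : ℕ) : ℤ) ≤ x 0 - x 1 := by exact_mod_cast hlo'
      have hhi'' : x 0 - x 1 ≤ ((⌈Rp / sch.a k⌉₊ : ℕ) : ℤ) := by exact_mod_cast hhi'
      push_cast at hlo'' ⊢
      omega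
    unfold famObs
    refine Finset.sum_congr rfl fun i _ => ?_
    congr 1
    refine Finset.prod_congr rfl fun j _ => ?_
    exact smearedLatticeField_torusLift_congr hS r.curvature hϱ (box 4 (sch.L k)) (sch.a k) _ _ (F.f i j)
      (hwin i j) hUU'

/-- **P1, `layerAssembleU` form** (the shape the cyclic-chain formula `latticeSchwinger_eq_diagCyclicU` integrates over): eventually in `k`,
the family observable at the periodic lift of the configuration assembled from layers `Z : ℤ/S_kℤ → LayerCfg` depends only on
`Z 1, …, Z d_k`, with the same depth sequence as `exists_famDepth`. -/
theorem exists_famDepth_layerAssembleU (F : ReflectedFamily) :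
    ∃ d : ℕ → ℕ, (∃ R' : ℝ, ∀ᶠ k in atTop, sch.a k * d k ≤ R') ∧ (∀ᶠ k in atTop, 2 * d k < sch.side k) ∧
      ∀ᶠ k in atTop, ∀ Z Z' : ZMod (sch.side k) → LayerCfg (sch.side k) (sch.side k) G,
        (∀ t : ℤ, 1 ≤ t → t ≤ d k → Z (t : ZMod (sch.side k)) = Z' (t : ZMod (sch.side k))) →
        famObs r sch F k (torusLift (sch.side k) (layerAssembleU Z)) =
          famObs r sch F k (torusLift (sch.side k) (layerAssembleU Z')) := by
  obtain ⟨d, hd1, hd2, hd3⟩ := exists_famDepth r sch F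
  refine ⟨d, hd1, hd2, ?_⟩
  filter_upwards [hd3] with k hk Z Z' hZZ'
  have hS : Odd (sch.side k) := ⟨sch.L k, rfl⟩
  refine hk _ _ fun t htlo hthi => ?_
  rw [layerReadU_layerAssembleU hS, layerReadU_layerAssembleU hS]
  exact hZZ' t htlo hthi

end Depth

end Summit.QuantumFields.YangMills.Cruxes.DiagonalMirrorRPR.SignTwistedDiagonalTrace.WilsonDiagonal

end
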